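import Literature.MathematicalPhysics.KineticTheory.HardSphereEulerProofs

/-!
# Uniform exponential moments of the velocity and kinetic-energy fluctuations of a local Maxwellian

Helper file for item `LocalGibbsConcentrationDilute` (stmt-AtomisticToContinuum-13460) of route
`JaynesSqueeze`. For continuous velocity / temperature profiles `u₀`, `θ₀ > 0` on `𝕋³` there are
`t₀, B > 0` such that, uniformly in `x ∈ 𝕋³`, under the Gaussian `N(u₀(x), θ₀(x) id)`
(`gaussMeasure`) the centred observables

* `v ↦ vₗ - u₀(x)ₗ` (momentum coordinate fluctuation) and
* `v ↦ |v|²/2 - |u₀(x)|²/2 - 3θ₀(x)/2` (kinetic-energy fluctuation)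

satisfy `∫ e^{t₀ |·|} ≤ B` (`exists_expMoment_velFluct`): after the affine change of variables
`v = u + √θ w` both are dominated by `A + Θ |w|²`, and `e^{C|w|²}` is integrable for the standard
Gaussian by Fernique's theorem (`IsGaussian.exists_integrable_exp_sq`).

No definitions (pure-proof helper file). prover-pitem-stmt-AtomisticToContinuum-13460-0.
-/

noncomputable section

namespace Summit.AtomisticToContinuum.HydrodynamicLimit.Theorems

open MeasureTheory ProbabilityTheory Filter Topology Set
open Literature.Analysis.FluidPDE Literature.MathematicalPhysics.KineticTheory
open scoped ENNReal InnerProductSpace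

namespace LocalGibbsConcentration

section Transfer

/-- Integrability against `gaussMeasure u θ` is integrability of `g (u + √θ w)` against the
standard Gaussian (`θ > 0`). [folklore] -/
theorem integrable_gaussMeasure_iff {u : V3} {θ : ℝ} (hθ : 0 < θ) (g : V3 → ℝ) :
    Integrable g (gaussMeasure u θ) ↔
      Integrable (fun w => g (u + Real.sqrt θ • w)) (stdGaussian V3) := by
  rw [gaussMeasure, ← coe_gaussShiftEquiv u hθ, integrable_map_equiv]
  rfl

/-- Domination principle: if `|g(u + √θ w)| ≤ A + C |w|²` pointwise with `e^{C|w|²}` integrable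
for the standard Gaussian, then `e^{|g|}` is integrable for `gaussMeasure u θ` with
`∫ e^{|g|} ≤ e^{A} ∫ e^{C|w|²}`. [folklore] -/
theorem integral_exp_abs_gaussMeasure_le {u : V3} {θ : ℝ} (hθ : 0 < θ) {g : V3 → ℝ}
    (hg : Measurable g) {A C : ℝ}
    (hC : Integrable (fun w : V3 => Real.exp (C * ‖w‖ ^ 2)) (stdGaussian V3))
    (hdom : ∀ w : V3, |g (u + Real.sqrt θ • w)| ≤ A + C * ‖w‖ ^ 2) :
    Integrable (fun v => Real.exp |g v|) (gaussMeasure u θ) ∧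
      ∫ v, Real.exp |g v| ∂gaussMeasure u θ ≤
        Real.exp A * ∫ w, Real.exp (C * ‖w‖ ^ 2) ∂stdGaussian V3 := by
  have hpt : ∀ w : V3, Real.exp |g (u + Real.sqrt θ • w)| ≤
      Real.exp A * Real.exp (C * ‖w‖ ^ 2) := fun w => by
    rw [← Real.exp_add, Real.exp_le_exp]
    exact hdom w
  have hint : Integrable (fun w : V3 => Real.exp |g (u + Real.sqrt θ • w)|) (stdGaussian V3) := by
    refine (hC.const_mul (Real.exp A)).mono' ?_ (Eventually.of_forall fun w => ?_)
    · exact (Real.continuous_exp.measurable.comp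
        ((hg.comp (measurable_gaussShift u θ)).abs)).aestronglyMeasurable
    · rw [Real.norm_eq_abs, abs_of_pos (Real.exp_pos _)]
      exact hpt w
  refine ⟨(integrable_gaussMeasure_iff hθ _).2 hint, ?_⟩
  rw [integral_gaussMeasure u hθ, ← integral_const_mul]
  exact integral_mono hint (hC.const_mul _) hpt

end Transfer

section Moments

variable {θ₀ : T3 → ℝ} {u₀ : T3 → V3}

/-- Pointwise domination of the momentum-coordinate fluctuation: with `v = u + √θ w`,
`|vₗ - uₗ| = √θ |wₗ| ≤ (1 + θ |w|²)/2 · …`; precisely `t |√θ wₗ| ≤ t/2 + (t θ / 2) |w|²` for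
`t ≥ 0`. [folklore] -/
theorem mul_abs_coord_fluct_le {θ t : ℝ} (hθ : 0 ≤ θ) (ht : 0 ≤ t) (u w : V3) (l : Fin 3) :
    t * |(u + Real.sqrt θ • w) l - u l| ≤ t / 2 * (1 + θ) + t / 2 * (1 + θ) * ‖w‖ ^ 2 := by
  have h1 : (u + Real.sqrt θ • w) l - u l = Real.sqrt θ * w l := by simp
  rw [h1, abs_mul, abs_of_nonneg (Real.sqrt_nonneg θ)]
  have hwl : |w l| ≤ ‖w‖ := by
    simpa using PiLp.norm_apply_le w l
  have hsq : Real.sqrt θ ≤ (1 + θ) / 2 := by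
    nlinarith [Real.sq_sqrt hθ, sq_nonneg (Real.sqrt θ - 1), Real.sqrt_nonneg θ]
  have hw : ‖w‖ ≤ (1 + ‖w‖ ^ 2) / 2 := by nlinarith [sq_nonneg (‖w‖ - 1), norm_nonneg w]
  calc t * (Real.sqrt θ * |w l|) ≤ t * ((1 + θ) / 2 * ((1 + ‖w‖ ^ 2) / 2)) := by
        refine mul_le_mul_of_nonneg_left ?_ ht
        exact mul_le_mul (hsq) (hwl.trans hw) (abs_nonneg _) (by positivity)
    _ ≤ t / 2 * (1 + θ) + t / 2 * (1 + θ) * ‖w‖ ^ 2 := by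
        nlinarith [sq_nonneg ‖w‖, mul_nonneg ht (add_nonneg zero_le_one hθ)]

/-- Pointwise domination of the kinetic-energy fluctuation: with `v = u + √θ w`,
`t ||v|²/2 - |u|²/2 - 3θ/2| ≤ t (|u|² + 3θ)/2 + t θ |w|²`. [folklore] -/
theorem mul_abs_energy_fluct_le {θ t : ℝ} (hθ : 0 ≤ θ) (ht : 0 ≤ t) (u w : V3) :
    t * |‖u + Real.sqrt θ • w‖ ^ 2 / 2 - ‖u‖ ^ 2 / 2 - Fintype.card (Fin 3) * θ / 2| ≤
      t * ((‖u‖ ^ 2 + 3 * θ) / 2) + t * θ * ‖w‖ ^ 2 := by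
  rw [energy_shift_eq u hθ w, Fintype.card_fin]
  have hin : |⟪u, w⟫_ℝ| ≤ ‖u‖ * ‖w‖ := abs_real_inner_le_norm u w
  have hamgm : Real.sqrt θ * (‖u‖ * ‖w‖) ≤ (‖u‖ ^ 2 + θ * ‖w‖ ^ 2) / 2 := by
    nlinarith [sq_nonneg (‖u‖ - Real.sqrt θ * ‖w‖), Real.sq_sqrt hθ]
  have habs : |Real.sqrt θ * ⟪u, w⟫_ℝ + θ / 2 * (‖w‖ ^ 2 - (3 : ℕ))| ≤
      (‖u‖ ^ 2 + θ * ‖w‖ ^ 2) / 2 + θ / 2 * ‖w‖ ^ 2 + 3 * θ / 2 := by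
    refine (abs_add_le _ _).trans ?_
    have h1 : |Real.sqrt θ * ⟪u, w⟫_ℝ| ≤ (‖u‖ ^ 2 + θ * ‖w‖ ^ 2) / 2 := by
      rw [abs_mul, abs_of_nonneg (Real.sqrt_nonneg θ)]
      exact (mul_le_mul_of_nonneg_left hin (Real.sqrt_nonneg θ)).trans hamgm
    have h2 : |θ / 2 * (‖w‖ ^ 2 - (3 : ℕ))| ≤ θ / 2 * ‖w‖ ^ 2 + 3 * θ / 2 := by
      rw [abs_mul, abs_of_nonneg (by positivity : (0 : ℝ) ≤ θ / 2)]
      have : |‖w‖ ^ 2 - ((3 : ℕ) : ℝ)| ≤ ‖w‖ ^ 2 + 3 := by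
        refine (abs_sub _ _).trans ?_
        simp [abs_of_nonneg (sq_nonneg ‖w‖)]
      calc θ / 2 * |‖w‖ ^ 2 - ((3 : ℕ) : ℝ)| ≤ θ / 2 * (‖w‖ ^ 2 + 3) :=
            mul_le_mul_of_nonneg_left this (by positivity)
        _ = θ / 2 * ‖w‖ ^ 2 + 3 * θ / 2 := by ring
    linarith
  calc t * |Real.sqrt θ * ⟪u, w⟫_ℝ + θ / 2 * (‖w‖ ^ 2 - (3 : ℕ))|
      ≤ t * ((‖u‖ ^ 2 + θ * ‖w‖ ^ 2) / 2 + θ / 2 * ‖w‖ ^ 2 + 3 * θ / 2) :=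
        mul_le_mul_of_nonneg_left habs ht
    _ = t * ((‖u‖ ^ 2 + 3 * θ) / 2) + t * θ * ‖w‖ ^ 2 := by ring

/-- **Uniform exponential moments of the velocity fluctuations of a local Maxwellian.** For
continuous `u₀`, `θ₀ > 0` on `𝕋³` there are `t₀, B > 0` with, for all `x` and all coordinates
`l`, `∫ exp(t₀ |vₗ - u₀(x)ₗ|) dN(u₀(x), θ₀(x)) ≤ B` and
`∫ exp(t₀ ||v|²/2 - |u₀(x)|²/2 - 3θ₀(x)/2|) dN(u₀(x), θ₀(x)) ≤ B`, all integrands being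
integrable (Fernique's theorem for the standard Gaussian on `ℝ³` and compactness of `𝕋³`).
[folklore] -/
theorem exists_expMoment_velFluct (hθ : Continuous θ₀) (hu : Continuous u₀)
    (hθ0 : ∀ x, 0 < θ₀ x) :
    ∃ t₀ B : ℝ, 0 < t₀ ∧ 0 < B ∧
      (∀ (x : T3) (l : Fin 3),
        Integrable (fun v : V3 => Real.exp (t₀ * |v l - u₀ x l|)) (gaussMeasure (u₀ x) (θ₀ x)) ∧
        ∫ v, Real.exp (t₀ * |v l - u₀ x l|) ∂gaussMeasure (u₀ x) (θ₀ x) ≤ B) ∧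
      (∀ x : T3,
        Integrable (fun v : V3 => Real.exp (t₀ * |‖v‖ ^ 2 / 2 - ‖u₀ x‖ ^ 2 / 2 -
          Fintype.card (Fin 3) * θ₀ x / 2|)) (gaussMeasure (u₀ x) (θ₀ x)) ∧
        ∫ v, Real.exp (t₀ * |‖v‖ ^ 2 / 2 - ‖u₀ x‖ ^ 2 / 2 - Fintype.card (Fin 3) * θ₀ x / 2|)
          ∂gaussMeasure (u₀ x) (θ₀ x) ≤ B) := by
  -- Fernique constant of the standard Gaussian on `ℝ³`
  obtain ⟨CF, hCF, hFer⟩ := IsGaussian.exists_integrable_exp_sq (stdGaussian V3)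
  -- uniform bounds on the profiles
  obtain ⟨Θ, hΘpos, hΘ⟩ := exists_forall_abs_le_of_continuous hθ
  obtain ⟨U, hUpos, hU⟩ := exists_forall_abs_le_of_continuous (hu.norm)
  have hθle : ∀ x, θ₀ x ≤ Θ := fun x => (le_abs_self _).trans (hΘ x)
  have hule : ∀ x, ‖u₀ x‖ ≤ U := fun x => (le_abs_self _).trans ((abs_norm (u₀ x)).symm ▸ hU x)
  set Θ' : ℝ := 1 + Θ with hΘ'
  have hΘ'pos : 0 < Θ' := by positivity
  -- the rate
  set t₀ : ℝ := CF / Θ' with ht₀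
  have ht₀pos : 0 < t₀ := div_pos hCF hΘ'pos
  set IF : ℝ := ∫ w, Real.exp (CF * ‖w‖ ^ 2) ∂stdGaussian V3 with hIF
  have hIFpos : 0 < IF := by
    rw [hIF]
    exact integral_exp_pos hFer
  set B : ℝ := Real.exp (CF * (U ^ 2 + 3 * Θ')) * IF with hB
  have hBpos : 0 < B := mul_pos (Real.exp_pos _) hIFpos
  refine ⟨t₀, B, ht₀pos, hBpos, fun x l => ?_, fun x => ?_⟩
  · -- momentum coordinate
    have hdom : ∀ w : V3, abs (t₀ * |(u₀ x + Real.sqrt (θ₀ x) • w) l - u₀ x l|)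
        ≤ t₀ / 2 * (1 + θ₀ x) + CF * ‖w‖ ^ 2 := by
      intro w
      rw [abs_of_nonneg (mul_nonneg ht₀pos.le (abs_nonneg _))]
      refine (mul_abs_coord_fluct_le (hθ0 x).le ht₀pos.le (u₀ x) w l).trans ?_
      have hc : t₀ / 2 * (1 + θ₀ x) ≤ CF := by
        rw [ht₀]
        have h1 : 1 + θ₀ x ≤ Θ' := by rw [hΘ']; linarith [hθle x]
        calc CF / Θ' / 2 * (1 + θ₀ x) ≤ CF / Θ' / 2 * Θ' :=
              mul_le_mul_of_nonneg_left h1 (by positivity)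
          _ = CF / 2 := by field_simp
          _ ≤ CF := by linarith
      nlinarith [sq_nonneg ‖w‖]
    have h := integral_exp_abs_gaussMeasure_le (hθ0 x) (g := fun v => t₀ * |v l - u₀ x l|)
      ((measurable_const.mul ((measurable_pi_apply l |>.comp (by fun_prop : Measurable fun v : V3 => (WithLp.ofLp v))).sub measurable_const).abs)) hFer hdom
    simp_rw [abs_of_nonneg (mul_nonneg ht₀pos.le (abs_nonneg _))] at h
    refine ⟨h.1, h.2.trans ?_⟩
    rw [hB]
    refine mul_le_mul_of_nonneg_right (Real.exp_le_exp.2 ?_) hIFpos.le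
    have h1 : 1 + θ₀ x ≤ Θ' := by rw [hΘ']; linarith [hθle x]
    have h2 : t₀ ≤ CF := by
      rw [ht₀, div_le_iff₀ hΘ'pos]
      have : (1 : ℝ) ≤ Θ' := by rw [hΘ']; linarith
      nlinarith
    nlinarith [sq_nonneg U, hθ0 x]
  · -- kinetic energy
    have hdom : ∀ w : V3, abs (t₀ * |‖u₀ x + Real.sqrt (θ₀ x) • w‖ ^ 2 / 2 - ‖u₀ x‖ ^ 2 / 2 -
        Fintype.card (Fin 3) * θ₀ x / 2|) ≤ t₀ * ((‖u₀ x‖ ^ 2 + 3 * θ₀ x) / 2) + CF * ‖w‖ ^ 2 := by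
      intro w
      rw [abs_of_nonneg (mul_nonneg ht₀pos.le (abs_nonneg _))]
      refine (mul_abs_energy_fluct_le (hθ0 x).le ht₀pos.le (u₀ x) w).trans ?_
      have hc : t₀ * θ₀ x ≤ CF := by
        rw [ht₀]
        have h1 : θ₀ x ≤ Θ' := by rw [hΘ']; linarith [hθle x]
        calc CF / Θ' * θ₀ x ≤ CF / Θ' * Θ' := mul_le_mul_of_nonneg_left h1 (by positivity)
          _ = CF := by field_simp
      nlinarith [sq_nonneg ‖w‖]
    have hmeas : Measurable fun v : V3 => t₀ * |‖v‖ ^ 2 / 2 - ‖u₀ x‖ ^ 2 / 2 -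
        Fintype.card (Fin 3) * θ₀ x / 2| := by fun_prop
    have h := integral_exp_abs_gaussMeasure_le (hθ0 x) hmeas hFer hdom
    simp_rw [abs_of_nonneg (mul_nonneg ht₀pos.le (abs_nonneg _))] at h
    refine ⟨h.1, h.2.trans ?_⟩
    rw [hB]
    refine mul_le_mul_of_nonneg_right (Real.exp_le_exp.2 ?_) hIFpos.le
    have h1 : θ₀ x ≤ Θ' := by rw [hΘ']; linarith [hθle x]
    have h2 : t₀ ≤ CF := by
      rw [ht₀, div_le_iff₀ hΘ'pos]
      have : (1 : ℝ) ≤ Θ' := by rw [hΘ']; linarith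
      nlinarith
    have h3 : ‖u₀ x‖ ^ 2 ≤ U ^ 2 := pow_le_pow_left₀ (norm_nonneg _) (hule x) 2
    nlinarith [hθ0 x, sq_nonneg ‖u₀ x‖]

end Moments

end LocalGibbsConcentration

end Summit.AtomisticToContinuum.HydrodynamicLimit.Theorems
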